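import Literature.MathematicalPhysics.QuantumFieldTheory.Balaban1983to89.Node00.TorusCoverLandau153RecTowerDoorGradPrecompExplicit
import Literature.MathematicalPhysics.QuantumFieldTheory.Balaban1983to89.Node00.TorusCoverLandau153RecDatumDoorGrad

/-!
# EXPLICIT-`u` EDITION (dag-n07-e g32, URGENT-2 2026-08-30 03:05Z) of dag-n07-w3 g13's `Node00.TorusCoverLandau153RecDatumDoorGradPrecomp` (p758087) — TOKEN TWIN: the
# member gauge `um` is a BINDER instead of `∃ u` inside `hG` ∕ `∃ um` in the exported tuple; statement and proof otherwise byte-identical (text by dag-n07-w3; the edit: binder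
# added, two existentials deleted, one tuple slot fewer), over the STAGE 1–2 explicit twin `…RecTowerDoorGradPrecompExplicit`.  WHY: the junction's row 9′ needs the NAME
# `um = h⁻¹·u₀` in the door formula; consumed by dag-n07-e's MODULE 129 `Summits/…/BalabanUVNodesN07Thm4Rows152OfDatumCrownPhiAt`.
#
# NODE 00 — THE R7 DOOR, STAGE 3 (generic dented record cube `c`, canonical windows `□₀ᶻ ∕ □ᶻ ∕ □̃ᶻ`), **PRE-COMPOSED EDITION**: `exists_localGauge152_recTower_member_grad` (g12, §1)
# VERBATIM with the TWO pass-through conjuncts `Restr129Z L k Λ′ 1 u` and the (1.137) row `logCovIterZ … = mlog (avgIterZ (c.axial V) …)` DELETED from the input `hG` and from the exported tuple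

Cell `pub-ymgap`, width seat `pub-ymgap-dag-n07-w3` g13 (junction side of the K0 road; (W2) door re-cut (P-a), second file; located by dag-n07-e g32 ⚑ LOCATED-W2-DOOR).
`--kind proof --supports stmt-QuantumFields-20541` (K0⁷; count-neutral; THEOREMS ONLY, 0 `def`).  [6] = [Balaban1985RegularSpaces]; [15] = [Balaban1985Variational]; [I] = [Balaban1987RG1].
CONSUMED BY NAME, nothing modified: this seat's STAGE 1–2 pre-composed edition `Node00.TorusCoverLandau153RecTowerDoorGradPrecomp.exists_localGauge152_recTower_window_member_grad_precomp_explicit`,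
g10's `Node00.TorusCoverLandau153RecDatumDoor ∕ …RecDatumDoorOfCrown` window dictionaries (`injOn_coverShift_tcubeZ`, `image_coverShift_cubeZ ∕ _boxZ`, `CubeB8DZ.add_e_mem_sq_zero_of_shift_mem_image`,
`add_e_mem_boxZ_of_shift_mem_image`, `sub_e_mem_boxZ_of_unshift_mem_image`, `sq_zero_subset_tcube`, `sq_subset_sq_zero`), `B8Eq131CubesRec.box_subset_cube(_top)`, `B8Eq131Cubes.cube_subset_tcube`.

WHY.  See the STAGE 1–2 file: the junction's φ-road feeds the door with the pre-composed crown's gauge function `u := h⁻¹·u₀`, for which the pass-through conjunct `Restr129Z … u` is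
false and the (1.137) row has the pre-composed shape; neither is read anywhere in the door chain.  THIS FILE is STAGE 3 §1 of g12's ✓`…RecDatumDoorGrad` at a GENERIC dented record cube `c : CubeB8DZ P.d P.L K′ Ω′` (dag-n07-e's (W2) knit
instantiates it at this seat's dented print datum `recordCubePZ … Dtop`, ✓p749305); §2–§3 of the original (the `propCubePZ` datum door and the crown door) are NOT twinned.

WHAT IS PROVED (sorry-free).  ★★ `exists_localGauge152_recTower_member_grad_precomp_explicit` — g12's §1 statement minus the two conjuncts, proof verbatim over the pre-composed STAGE 2.
HONEST FRAMING: count-neutral helper; a TOKEN-DELETION twin of landed helper files (no landed theorem is wrong: the deleted conjunct is TRUE where the originals are used, it is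
merely unavailable for the junction's precomposed gauge function); nothing of [6]∕[15]∕[I] asserted or discharged; `DatumCrownPhiAt` ∕ `HThm4RecSym152PhiE(G)` ∕ `HThm4Rec*`
DISPLAYED∕CONDITIONAL; N05 ∕ N07 NOT discharged; K0⁷ ∕ K1⁹ NOT closed; counts unmoved (typed 28∕28 · discharged 8∕28); one finite 𝕋⁴ programme at fixed ε — R4 closes the conditional
finite-𝕋⁴ rung `BalabanLadder.UV` only; the YM mass gap (Clay) is NOT proved by any of this; nothing continuum ∕ ℝ⁴ ∕ OS.  No `def`, no `instance`, no `notation`, no `sorry`.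

References: [15] (144)–(153) pp. 300–301; [6] Prop. 6 (1.135)–(1.138) p. 99, (1.29) p. 81, (1.131) p. 99, p. 98; [3] = [Balaban1985Averaging] (78)–(81) p. 30; [I] (0.1) p. 251, (0.3)–(0.4) pp. 252–253.
-/

noncomputable section

namespace Literature.MathematicalPhysics.QuantumFieldTheory.Balaban1983to89.Node00

open scoped Matrix.Norms.L2Operator
open B7Prop1Explicit (e e_apply gaugeAct)
open B7Prop1Local (InBox AgreeOn)
open B7Prop2Explicit (unitaryUnits mem_unitaryUnits)
open B7Prop2SpecialUnitary (specialUnitaryUnits mem_specialUnitaryUnits)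
open BlockAveragingZd (avgIterZ ctrShift)
open B8Ineq132 (covDerivFwd covDeriv BondTouches InAk)
open B8Eq131Cubes (box cube tcube tLo tHi ctr gs)
open B8Eq131CubesRec (boxZ cubeZ tcubeZ bLoZ bHiZ)
open B8Eq131CubesRecDictionary (mem_cubeZ_iff_add_ctrShift)
open B8Eq140Level (SideTouches)
open B8Eq138LandauZd (logCfg covDivB covLap)
open B8Eq138LandauZdRec (IsLandau138Z IsLandau138WZ)
open B7SectEFLinearisationRec (logCovIterZ)
open B8Eq184Proof (cfgExp)
open B8LeafModelZd3 (mlogCfg)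
open B8ScaledSupNorm (msup Bdd bondNorm)
open B8Eq146AExpansion (plaqCovDeriv iEta)
open B8Eq143PlaqExpansion (pdiv)
open MatrixLog (mlog)
open B15Eq112TorusCover (cover)
open B14DomainGeom (Pt)
open B12RegularSpaces111 (gaugeU expI grad)
open B6SectADomainsV1 (Domains)
open B6SectAOperatorsV1 (RE dsE QpE)
open BalabanImbrieJaffe1984to88.BIJ85AxialPropagator411 (BondSpace)

variable {P : Params} {N : ℕ} [NeZero N]

/-! ## §1  STAGE 3, pre-composed edition -/

/-- ★★ **STAGE 3 OF THE R7 DOOR (canonical windows `□₀ᶻ ∕ □ᶻ ∕ □̃ᶻ`), PRE-COMPOSED EDITION** — g12's `exists_localGauge152_recTower_member_grad` with the pass-through conjuncts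
`Restr129Z P.L c.k c.lamS 1 u` and (1.137) `logCovIterZ … = mlog (avgIterZ P.L (c.axial V) …)` deleted from `hG` and from the exported tuple; proof verbatim over the pre-composed STAGE 2.
[cite: Balaban1985Variational, (144)–(153) pp.300–301; Balaban1985RegularSpaces, Prop. 6 (1.135)–(1.138) p.99, (1.29) p.81, (1.131) p.99, p.98; Balaban1985Averaging, (78)–(81) p.30; Balaban1987RG1, (0.1) p.251, (0.3)–(0.4) pp.252–253]
EXPLICIT-`u` EDITION: the member gauge `um` is a binder and the exported rows name it (no `∃ u` in `hG`, no `∃ um`). -/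
theorem exists_localGauge152_recTower_member_grad_precomp_explicit (hd : 2 ≤ P.d) {K' : ℕ} {Ω' : ℕ → Set (B7Prop1Explicit.Site P.d)} (c : CubeB8DZ P.d P.L K' Ω')
    (U : GaugeField P 0 (SU N)) {n : ℕ} (hk : c.k = n) {r : ℝ} (hr : 0 ≤ r)
    (um : B7Prop1Explicit.Site P.d → (MatA N)ˣ) (hG : letI : CStarAlgebra (MatA N) := {};
      (∀ x, um x ∈ specialUnitaryUnits (Fin N)) ∧ (∀ x, x ∉ c.sq 0 → um x = 1) ∧
        IsLandau138WZ P.L c.k (P.eta n) (c.sq 0) c.lamS (1 : B7Prop1Explicit.Site P.d → Fin P.d → (MatA N)ˣ)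
          (c.fixed (fun x μ => ιSU N (U ⟨cover P (x + fun _ => (ctrShift P.L c.k : ℤ)), μ⟩)) um) ∧
        (∀ j, j ≤ c.k → ∀ b ∈ {b : B7Prop1Explicit.Site P.d × Fin P.d | SideTouches (c.sq j) b.1 b.2},
          c.fixed (fun x μ => ιSU N (U ⟨cover P (x + fun _ => (ctrShift P.L c.k : ℤ)), μ⟩)) um b.1 b.2 =
              cfgExp (P.eta n) (logCfg (P.eta n) (c.fixed (fun x μ => ιSU N (U ⟨cover P (x + fun _ => (ctrShift P.L c.k : ℤ)), μ⟩)) um)) b.1 b.2 ∧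
            IsSelfAdjoint (logCfg (P.eta n) (c.fixed (fun x μ => ιSU N (U ⟨cover P (x + fun _ => (ctrShift P.L c.k : ℤ)), μ⟩)) um) b.1 b.2) ∧
            ‖logCfg (P.eta n) (c.fixed (fun x μ => ιSU N (U ⟨cover P (x + fun _ => (ctrShift P.L c.k : ℤ)), μ⟩)) um) b.1 b.2‖ ≤ r * ((P.L : ℝ) ^ j * P.eta n)⁻¹) ∧
        (∀ x, ((c.vfix (fun x μ => ιSU N (U ⟨cover P (x + fun _ => (ctrShift P.L c.k : ℤ)), μ⟩)))⁻¹ * um) x ∈ specialUnitaryUnits (Fin N)) ∧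
        AgreeOn (B8Ineq130Rec.tlo P.L (tLo c.a c.ρ) c.k) (B8Ineq130Rec.thi P.L (tHi c.a c.M c.ρ) c.k)
          (gaugeAct ((c.vfix (fun x μ => ιSU N (U ⟨cover P (x + fun _ => (ctrShift P.L c.k : ℤ)), μ⟩)))⁻¹ * um)⁻¹
            (fun x μ => ιSU N (U ⟨cover P (x + fun _ => (ctrShift P.L c.k : ℤ)), μ⟩)))
          (c.fixed (fun x μ => ιSU N (U ⟨cover P (x + fun _ => (ctrShift P.L c.k : ℤ)), μ⟩)) um) ∧
        msup P.L c.k (P.eta n) (-(2 : ℝ)) (fun j (q : Fin P.d × Fin P.d × B7Prop1Explicit.Site P.d) => SideTouches (c.sq j) q.2.2 q.2.1)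
            (fun q => covDerivFwd (P.eta n) (1 : B7Prop1Explicit.Site P.d → Fin P.d → (MatA N)ˣ) q.1
              (fun z => c.expo (P.eta n) (fun x μ => ιSU N (U ⟨cover P (x + fun _ => (ctrShift P.L c.k : ℤ)), μ⟩)) um z q.2.1) q.2.2) ≤ r ∧
        bondNorm P.L c.k (P.eta n) (-(3 : ℝ)) c.sq
            (fun x μ => pdiv (P.eta n) (1 : B7Prop1Explicit.Site P.d → Fin P.d → (MatA N)ˣ)
              (plaqCovDeriv (P.eta n) (1 : B7Prop1Explicit.Site P.d → Fin P.d → (MatA N)ˣ)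
                (c.expo (P.eta n) (fun x μ => ιSU N (U ⟨cover P (x + fun _ => (ctrShift P.L c.k : ℤ)), μ⟩)) um)) μ x) ≤ r ∧
        bondNorm P.L c.k (P.eta n) (-(3 : ℝ)) c.sq
            (fun x μ => covLap (P.eta n) (1 : B7Prop1Explicit.Site P.d → Fin P.d → (MatA N)ˣ)
              (fun z => c.expo (P.eta n) (fun x μ => ιSU N (U ⟨cover P (x + fun _ => (ctrShift P.L c.k : ℤ)), μ⟩)) um z μ) x) ≤ r)
    (hinj : Set.InjOn (cover P) (tcube P.L c.a c.M c.ρ c.k)) (h4 : 4 * ((N : ℝ) * r) < 2 * Real.pi) :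
    letI : CStarAlgebra (MatA N) := {}
    ∃ u : GaugeTransf P 0 (SU N), ∃ A : PBond P 0 → MatA N,
      (∀ b ∈ (Sect2.regionOfSet P (cover P '' cube P.L c.a c.M c.ρ c.k 0)).bonds, gaugeU (fun x => ιSU N (u x)) (fun b' => ιSU N (U b')) b = expI (P.eta n) (A b)) ∧
      (∀ j, j ≤ c.k → ∀ (x : Pt P.d) (μ : Fin P.d), x ∈ c.sq j → x + e μ ∈ c.sq j →
          ‖A ⟨cover P (x + fun _ => (ctrShift P.L c.k : ℤ)), μ⟩‖ ≤ 2 * (r * ((P.L : ℝ) ^ j * P.eta n)⁻¹)) ∧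
      (∀ b ∈ (Sect2.regionOfSet P (cover P '' box P.L c.a c.M c.k)).bonds, ‖A b‖ ≤ 2 * (r * P.L)) ∧
      (∀ q ∈ (Sect2.regionOfSet P (cover P '' box P.L c.a c.M c.k)).dpairs, ‖grad (P.eta n) q.2.1 (fun y => A ⟨y, q.2.2⟩) q.1‖ ≤ 2 * (r * (P.L : ℝ) ^ 2)) ∧
      (∀ b ∈ Sect2.bondsDeep (cover P '' box P.L c.a c.M c.k), ‖Sect2.codiffCurlA (P.eta n) A b.src b.dir‖ ≤ 2 * (r * (P.L : ℝ) ^ 3)) ∧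
      (∀ b ∈ Sect2.bondsDeep (cover P '' box P.L c.a c.M c.k),
          ‖∑ ν : Fin P.d, ((P.eta n : ℝ) : ℂ)⁻¹ •
              (grad (P.eta n) ν (fun y => A ⟨y, b.dir⟩) (b.src.unshift ν) - grad (P.eta n) ν (fun y => A ⟨y, b.dir⟩) b.src)‖ ≤ 2 * (r * (P.L : ℝ) ^ 3)) ∧
      (∀ x, x ∈ tcubeZ P.L c.a c.M c.ρ c.k → ∀ μ,
          A ⟨cover P (x + fun _ => (ctrShift P.L c.k : ℤ)), μ⟩ = logCfg (P.eta n) (c.fixed (fun x μ => ιSU N (U ⟨cover P (x + fun _ => (ctrShift P.L c.k : ℤ)), μ⟩)) um) x μ) ∧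
      IsLandau138Z P.L c.k (P.eta n) (c.sq 0) c.lamS (1 : B7Prop1Explicit.Site P.d → Fin P.d → (MatA N)ˣ)
        (logCfg (P.eta n) (c.fixed (fun x μ => ιSU N (U ⟨cover P (x + fun _ => (ctrShift P.L c.k : ℤ)), μ⟩)) um)) ∧
      (∀ x, x ∈ c.sq 0 →
          ιSU N (u (cover P (x + fun _ => (ctrShift P.L c.k : ℤ)))) = (um x)⁻¹ * c.vfix (fun x μ => ιSU N (U ⟨cover P (x + fun _ => (ctrShift P.L c.k : ℤ)), μ⟩)) x) ∧
      (∀ x, um x ∈ specialUnitaryUnits (Fin N)) ∧ (∀ x, x ∉ c.sq 0 → um x = 1) ∧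
      -- ★ NEW (T2b input, ℤᵈ side, passed through): (152) member 2 at EVERY level for the exported `um`
      (∀ j, j ≤ c.k → ∀ (x : B7Prop1Explicit.Site P.d) (μ ν : Fin P.d), x ∈ c.sq j → x + e μ ∈ c.sq j →
          ‖logCfg (P.eta n) (c.fixed (fun x μ => ιSU N (U ⟨cover P (x + fun _ => (ctrShift P.L c.k : ℤ)), μ⟩)) um) (x + e μ) ν
              - logCfg (P.eta n) (c.fixed (fun x μ => ιSU N (U ⟨cover P (x + fun _ => (ctrShift P.L c.k : ℤ)), μ⟩)) um) x ν‖ ≤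
            2 * (P.eta n * r * (((P.L : ℝ) ^ j * P.eta n) ^ 2)⁻¹)) ∧
      -- ★ NEW (pass-through): the crown's `(−2)` row for `um`
      msup P.L c.k (P.eta n) (-(2 : ℝ)) (fun j (q : Fin P.d × Fin P.d × B7Prop1Explicit.Site P.d) => SideTouches (c.sq j) q.2.2 q.2.1)
          (fun q => covDerivFwd (P.eta n) (1 : B7Prop1Explicit.Site P.d → Fin P.d → (MatA N)ˣ) q.1
            (fun z => c.expo (P.eta n) (fun x μ => ιSU N (U ⟨cover P (x + fun _ => (ctrShift P.L c.k : ℤ)), μ⟩)) um z q.2.1) q.2.2) ≤ r := by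
  letI : CStarAlgebra (MatA N) := {}
  have hLo : Odd P.L := P.hL.1
  have hL : 2 ≤ P.L := P.hL.2
  have hρ1 : 1 ≤ c.ρ := le_trans (le_trans (by norm_num) hL) c.L_le_ρ
  -- the canonical windows `X := Ω′₀ = □₀ᶻ`, `X_t := □ᶻ`, `X′ := □̃ᶻ`
  have hXX' : c.sq 0 ⊆ tcubeZ P.L c.a c.M c.ρ c.k := CubeB8DZ.sq_zero_subset_tcube hLo hL c
  have hXt : boxZ P.L c.a c.M c.k ⊆ c.sq 0 := by
    rw [c.sq_zero]; exact B8Eq131CubesRec.box_subset_cube hLo (Nat.zero_le _)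
  have hbox : boxZ P.L c.a c.M c.k ⊆ cubeZ P.L c.a c.M c.ρ c.k c.k := B8Eq131CubesRec.box_subset_cube_top hLo c.a c.M c.ρ c.k
  have hinj' := injOn_coverShift_tcubeZ (P := P) (k := c.k) hinj
  have hinj0 : Set.InjOn (cover P) (cube P.L c.a c.M c.ρ c.k 0) := hinj.mono (B8Eq131Cubes.cube_subset_tcube hL hρ1 (Nat.zero_le _))
  obtain ⟨u, A, h1, hlev, h2, h3, h4c, h4', hA7, h5, hsid, hsu, hoff, hgradAll, hmsup⟩ :=
    exists_localGauge152_recTower_window_member_grad_precomp_explicit hd c U (fun _ => (ctrShift P.L c.k : ℤ)) hk hr um hG hXX' hXt hXX' hinj'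
      (fun x hx μ h => c.add_e_mem_sq_zero_of_shift_mem_image hinj hx h)
      (fun x hx μ h => c.add_e_mem_boxZ_of_shift_mem_image hinj0 hx h)
      (fun x hx ν h => c.sub_e_mem_boxZ_of_unshift_mem_image hinj0 hx h) subset_rfl hbox h4
  have himg0 : (fun x => cover P (x + fun _ => (ctrShift P.L c.k : ℤ))) '' c.sq 0 = cover P '' cube P.L c.a c.M c.ρ c.k 0 := by
    rw [c.sq_zero]; exact image_coverShift_cubeZ c.a c.M c.ρ (Nat.zero_le _)
  have himgt : (fun x => cover P (x + fun _ => (ctrShift P.L c.k : ℤ))) '' boxZ P.L c.a c.M c.k = cover P '' box P.L c.a c.M c.k :=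
    image_coverShift_boxZ c.a c.M c.k
  rw [himg0] at h1
  rw [himgt] at h2 h3 h4c h4'
  exact ⟨u, A, h1, fun j hj x μ hxj hxj' => hlev j hj x μ (c.sq_subset_sq_zero hj hxj) (c.sq_subset_sq_zero hj hxj') hxj hxj',
    h2, h3, h4c, h4', hA7, h5, hsid, hsu, hoff, hgradAll, hmsup⟩

end Literature.MathematicalPhysics.QuantumFieldTheory.Balaban1983to89.Node00

end
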